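import Literature.NumberTheory.GaloisRepresentations.IdeleBrauerLocalInvariantsDictionary
import Literature.NumberTheory.GaloisRepresentations.ArtinReciprocityCharacterFiniteProofs
import Literature.NumberTheory.GaloisRepresentations.GlobalArtinMapAbstractExtensionProofs
import Literature.NumberTheory.GaloisRepresentations.DecompositionGroupOfCompletion
import Literature.NumberTheory.Automorphic.AdicCompletionResidueCard
import HarnessLib

/-!
# The decomposition map through a completion agrees with the restriction along `F̄ → F̄_v`:
# `Γ_{F_v} → Gal(E_w/F_v) ≅ G_w ⊆ Gal(E/F)` versus `Γ_{F_v} → Γ_F → Gal(E/F)`; inertia and Frobenius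
# (Tate, C–F VII §1.1; Neukirch, *Algebraic Number Theory* II (9.6), I §9 (9.4)–(9.5))

Topic `NumberTheory/GaloisRepresentations`; namespace `Literature.NumberTheory.GaloisRepresentations.IdeleCohomology`
(sequel to door-c6 g12's `IdeleBrauerLocalInvariantsDictionary`: `decompIncl w`, `localPair w`,
`exists_algEquiv_localEmbedding_eq`).  Theorems only (no definition, no named fact, no instance, no notation,
no `sorry`); number fields in `Type`.

Let `E/F` be a finite Galois extension of number fields, `v` a finite place of `F`, `w ∣ v` a place of `E`,
`E_w / F_v` the completed layer.  There are two homomorphisms `Γ_{F_v} → Gal(E/F)`: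
* through the completion: `s ↦ decompIncl w (s|_{E_w})` — door-c5's `G_w ≃ Gal(E_w/F_v)` composed with the
  restriction of `s` to (the embedded copy of) `E_w` — this is the group component `(localPair w).f` of door-c6's
  local compatible pair;
* through the global closure: `s ↦ (res s)|_E` with `res = absGaloisRestrict F F_v : Γ_{F_v} → Γ_F` (the tree's
  chosen `F̄ → F̄_v`) — the group component of `(absUnitsPair F E).pullback res`.

They are attached to two `F`-embeddings `E → F̄_v`, which differ by an element `σ₀ ∈ Gal(E/F)`
(`exists_algEquiv_localEmbedding_eq`), hence

* §1 **`exists_conj_localPair_f`**: `σ₀ · (localPair w).f s = (absUnitsPair F E).f (res s) · σ₀` for all `s`, and for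
  `E/F` ABELIAN **`localPair_f_eq`**: the two maps COINCIDE;
* §2 (abelian `E/F`, `v` unramified in `E`) **`localPair_f_eq_one_of_mem_absInertia`**: the inertia group of
  `F_v` dies (`I_{𝔓₀} = res(I_{F_v})`, tree `inertia_adicCompletionPrime_eq_map_absInertia`, and
  `absRestrictNormalHom_eq_one_of_isUnramifiedIn`), and **`localPair_f_eq_galFrob`**: an arithmetic Frobenius
  `φ` of `F_v` goes to THE Frobenius `galFrob F E v` (tree `isArithFrobAt_absGaloisRestrict_adicCompletionPrime_iff`,
  `isArithFrobAt_absRestrictNormalHom`, `eq_galFrob`, `galFrob_embeddedField_eq`).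

HONEST FRAMING: classical (decomposition groups and completions); written for Route A of crux
`AnticycControlAdditiveK` (cell bsd-schneider): it lets the local invariant of an idèle class at an unramified
place be read through the tree's unramified-character formula `brauerInvariantEquiv_cyclicClass_of_unramified`.

## References
* J. W. S. Cassels, A. Fröhlich (eds.), *Algebraic Number Theory* (1967), Ch. VII (J. Tate) §1.1.
  [CasselsFrohlichANT1967]
* J. Neukirch, *Algebraic Number Theory* (1999), Ch. II §9 Prop. (9.6); Ch. I §9 (9.4)–(9.5). [NeukirchANT1999]
* J.-P. Serre, *Local Fields*, GTM 67 (1979), Ch. VII §5 Prop. 3 (conjugation acts trivially). [SerreLocalFields1979]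
-/

noncomputable section

open NumberField IsDedekindDomain CategoryTheory groupCohomology Function Field
open Literature.NumberTheory.Automorphic

namespace Literature.NumberTheory.GaloisRepresentations

namespace IdeleCohomology

open SemiLocal Literature.Algebra.Homology DiscreteGaloisModule IsNonarchimedeanLocalField

variable {F : Type} [Field F] [NumberField F] {E : Type} [Field E] [NumberField E] [Algebra F E] [IsGalois F E]
variable {v : HeightOneSpectrum (𝓞 F)}

/-! ## §1. The two maps `Γ_{F_v} → Gal(E/F)` are conjugate; equal for abelian layers -/

omit [NumberField E] in
/-- The group component of `absUnitsPair F E`: `γ ↦ e⁻¹ ∘ (γ|_{E₀}) ∘ e` for `e : E ≃ E₀ ⊆ F̄` (definitional).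
[cite: SerreGaloisCohomology1997, Ch. I §2.4] -/
theorem absUnitsPair_f_apply [FiniteDimensional F E] (γ : absoluteGaloisGroup F) :
    (absUnitsPair F E).f γ = (embeddedEquiv F E).autCongr.symm (resGal (embeddedField F E) γ) := rfl

/-- **The decomposition map through the completion and the restriction along `F̄ → F̄_v` are conjugate**:
there is `σ₀ ∈ Gal(E/F)` with `σ₀ · (localPair w).f s = (absUnitsPair F E).f (res s) · σ₀` for every `s ∈ Γ_{F_v}`
(the two `F`-embeddings `E → F̄_v` differ by `σ₀`). [cite: CasselsFrohlichANT1967, Ch. VII §1.1]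
[cite: SerreLocalFields1979, Ch. VII §5 Prop. 3] -/
theorem exists_conj_localPair_f (w : Place F E v) :
    ∃ σ₀ : E ≃ₐ[F] E, ∀ s : absoluteGaloisGroup (v.adicCompletion F),
      σ₀ * (localPair w).f s = (absUnitsPair F E).f (absGaloisRestrict F (v.adicCompletion F) s) * σ₀ := by
  haveI := finiteDimensional_place (K := F) w
  obtain ⟨φ, hφ⟩ := exists_unitsHom (F := F) (v.adicCompletion F)
  obtain ⟨σ₀, hσ₀⟩ := exists_algEquiv_localEmbedding_eq (F := F) (E := E) w
  -- the two embeddings `E → F̄_v`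
  set ι₁ : E →+* AlgebraicClosure (v.adicCompletion F) :=
    ((absClosureEmbedding F (v.adicCompletion F) : AlgebraicClosure F →+* AlgebraicClosure (v.adicCompletion F)).comp
      (embeddingToAbs F E : E →+* AlgebraicClosure F)) with hι₁
  set ι₂ : E →+* AlgebraicClosure (v.adicCompletion F) :=
    (((embeddingToAbs (v.adicCompletion F) ((w : HeightOneSpectrum (𝓞 E)).adicCompletion E)) :
        (w : HeightOneSpectrum (𝓞 E)).adicCompletion E →+* AlgebraicClosure (v.adicCompletion F)).comp
      (algebraMap E ((w : HeightOneSpectrum (𝓞 E)).adicCompletion E))) with hι₂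
  have hι : ∀ x : E, ι₂ x = ι₁ (σ₀ x) := hσ₀
  set P₁ := (absUnitsPair F E).pullback (absGaloisRestrict F (v.adicCompletion F)) φ with hP₁
  have h₁ := pullback_absUnitsPair_φ_ofMul F E (v.adicCompletion F) φ hφ
  have h₂ := localPair_φ_ofMul (F := F) (E := E) w
  refine ⟨σ₀, fun s => ?_⟩
  have key : σ₀ * (localPair w).f s = P₁.f s * σ₀ := by
    refine AlgEquiv.ext fun x => ?_
    rw [AlgEquiv.mul_apply, AlgEquiv.mul_apply]
    apply ι₁.injective
    rw [← hι, (localPair w).apply_f_apply_eq_smul (v.adicCompletion F) ι₂ h₂,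
      P₁.apply_f_apply_eq_smul (v.adicCompletion F) ι₁ h₁, hι]
  exact key

/-- **For an ABELIAN layer the two maps coincide**: `(localPair w).f s = (absUnitsPair F E).f (res s)` for all
`s ∈ Γ_{F_v}`. [cite: CasselsFrohlichANT1967, Ch. VII §1.1][cite: SerreLocalFields1979, Ch. VII §5 Prop. 3] -/
theorem localPair_f_eq (hcomm : ∀ a b : E ≃ₐ[F] E, Commute a b) (w : Place F E v)
    (s : absoluteGaloisGroup (v.adicCompletion F)) :
    (localPair w).f s = (absUnitsPair F E).f (absGaloisRestrict F (v.adicCompletion F) s) := by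
  obtain ⟨σ₀, hσ₀⟩ := exists_conj_localPair_f (F := F) (E := E) w
  have h := hσ₀ s
  rw [(hcomm σ₀ _).eq] at h
  exact mul_right_cancel h

/-- The same through `resGal`: `(localPair w).f s = e⁻¹ (res s)|_{E₀} e`. [cite: CasselsFrohlichANT1967, Ch. VII §1.1] -/
theorem localPair_f_eq_autCongr_symm_resGal (hcomm : ∀ a b : E ≃ₐ[F] E, Commute a b) (w : Place F E v)
    (s : absoluteGaloisGroup (v.adicCompletion F)) :
    (localPair w).f s =
      (haveI := finiteDimensional_place (K := F) w;
        (embeddedEquiv F E).autCongr.symm (resGal (embeddedField F E) (absGaloisRestrict F (v.adicCompletion F) s))) := by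
  haveI := finiteDimensional_place (K := F) w
  rw [localPair_f_eq hcomm w s, absUnitsPair_f_apply]

/-! ## §2. Unramified places: inertia dies, Frobenius goes to `galFrob` -/

omit [IsGalois F E] in
/-- `q_{F_v} = #(𝓞 F ⧸ v)` for the tree's local-field structure of `F_v` (the hypothesis `hq` of
`isArithFrobAt_absGaloisRestrict_adicCompletionPrime_iff`). [cite: NeukirchANT1999, Ch. II §9 Prop. (9.6)] -/
theorem residueFieldCard_adicCompletion_eq_card_quotient (v : HeightOneSpectrum (𝓞 F)) :
    residueFieldCard (v.adicCompletion F) = Nat.card (𝓞 F ⧸ v.asIdeal) := by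
  rw [Automorphic.residueFieldCard_adicCompletion_eq, v.residueCard_eq_card_quotient]

/-- **At a place unramified in an abelian `E`, the inertia group of `F_v` acts trivially**:
`(localPair w).f τ = 1` for `τ ∈ I_{F_v}` (`res τ ∈ I_{𝔓₀}` and `I_{𝔓₀}` has trivial image in `Gal(E/F)`).
[cite: NeukirchANT1999, Ch. I §9 Prop. (9.4), Ch. II §9 Prop. (9.6)] -/
theorem localPair_f_eq_one_of_mem_absInertia (hcomm : ∀ a b : E ≃ₐ[F] E, Commute a b) (w : Place F E v)
    (hunr : Algebra.IsUnramifiedIn (𝓞 E) v.asIdeal)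
    {τ : absoluteGaloisGroup (v.adicCompletion F)} (hτ : τ ∈ absInertia (v.adicCompletion F)) :
    (localPair w).f τ = 1 := by
  haveI := finiteDimensional_place (K := F) w
  rw [localPair_f_eq_autCongr_symm_resGal hcomm w τ, MulEquiv.map_eq_one_iff]
  have hmem : absGaloisRestrict F (v.adicCompletion F) τ ∈ (adicCompletionPrime F v).inertia (absoluteGaloisGroup F) := by
    rw [inertia_adicCompletionPrime_eq_map_absInertia]
    exact Subgroup.mem_map_of_mem _ hτ
  have hunr' : Algebra.IsUnramifiedIn (𝓞 (embeddedField F E)) v.asIdeal := (isUnramifiedIn_embeddedField_iff v).2 hunr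
  exact absRestrictNormalHom_eq_one_of_isUnramifiedIn (embeddedField F E) hunr' (adicCompletionPrime_mem_primesAbove F v) hmem

/-- **At a place unramified in an abelian `E`, an arithmetic Frobenius of `F_v` goes to THE Frobenius of `v`**:
`(localPair w).f φ = galFrob F E v` for `φ ∈ Γ_{F_v}` with `IsAbsArithFrob φ`.
[cite: NeukirchANT1999, Ch. I §9 (9.5), Ch. II §9 Prop. (9.6)][cite: CasselsFrohlichANT1967, Ch. VII §1.1] -/
theorem localPair_f_eq_galFrob (hcomm : ∀ a b : E ≃ₐ[F] E, Commute a b) (w : Place F E v)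
    (hunr : Algebra.IsUnramifiedIn (𝓞 E) v.asIdeal)
    {φ : absoluteGaloisGroup (v.adicCompletion F)} (hφ : IsAbsArithFrob φ) :
    (localPair w).f φ = galFrob F E v := by
  haveI := finiteDimensional_place (K := F) w
  haveI : IsMulCommutative (E ≃ₐ[F] E) := ⟨⟨fun a b => (hcomm a b).eq⟩⟩
  haveI : IsAbelianGalois F E := { }
  rw [localPair_f_eq_autCongr_symm_resGal hcomm w φ, MulEquiv.symm_apply_eq, ← galFrob_embeddedField_eq hunr]
  -- `res φ` is an arithmetic Frobenius at `𝔓₀`, hence so is its restriction to `E₀` at `𝔓₀ ∩ 𝓞 E₀`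
  have hfrob : IsArithFrobAt (𝓞 F) (absGaloisRestrict F (v.adicCompletion F) φ) (adicCompletionPrime F v) :=
    (isArithFrobAt_absGaloisRestrict_adicCompletionPrime_iff F v
      (residueFieldCard_adicCompletion_eq_card_quotient v) φ).2 hφ
  haveI : (adicCompletionPrime F v).IsPrime := (adicCompletionPrime_mem_primesAbove F v).1
  have hres := isArithFrobAt_absRestrictNormalHom (embeddedField F E) hfrob
  have hQ := comap_ringOfIntegersToIntegralClosure_mem_primesOver_of_mem_primesAbove (embeddedField F E)
    (adicCompletionPrime_mem_primesAbove F v)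
  have hunr' : Algebra.IsUnramifiedIn (𝓞 (embeddedField F E)) v.asIdeal := (isUnramifiedIn_embeddedField_iff v).2 hunr
  exact eq_galFrob (commute_of_isAbelianGalois (embeddedField F E)) hunr' hQ hres

end IdeleCohomology

end Literature.NumberTheory.GaloisRepresentations

end
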